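import Literature.NumberTheory.Rogawski1990.LocalUnitaryRankTwoHilbertSection              -- ★ p851427 FILE A (this seat): `exists_mem_local_two_of_invariants`, `nonsingInvUnit_mem_local_two`, `cmLocalForm_two_eq`
import Literature.NumberTheory.Rogawski1990.LocalNormFibreNonsplit                        -- ★ `charpoly_endoEmbLocal`, `IsLocalNormPair.charpoly_eq`
import Summits.HodgeConjecture.HodgeConjecture.Theorems.F0P3cStCharTSAdjugateEigen        -- ★ Jacobi `trace_adjugate_scalar_sub_eq_eval_derivative_charpoly`
import HarnessLib

/-!
# F0 · P3c · line LH6 «StCharTS» — datum-road slice S13d «FIBRE-REALISE★»: at a non-split place every NORM-ONE ROOT of `charpoly y`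
# (`y ∈ U(Φ₃)(L⁺_v)` regular) IS a matched stable class of `H_v = U(Φ₂) × U(Φ₁)` — the converse of the norm fibre
# [Rogawski1990, §5.4 p. 78; §4.3 p. 43; §3.1 p. 19; §1.9 p. 8]

Cell `pub/hodgecm-mathlib`, crux H413 = `stmt-HodgeConjecture-24833` (lane `--kind proof --supports … --as helper`), route HCCMUnconditional; seat LH4-p01 (g5);
datum road of LH6 (map owner LH6-p01 (g4)); OFFER 12:37Z taken up by the S13b holder F0P3-p02 (g20) 12:39:22Z («YES PLEASE, consumed BY NAME»): S13b «UPR-LC»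
needs «the matched classes near `x` are the norm-one roots of `charpoly`», i.e. this converse of ★ `IsLocalNormPair.isRoot_finGammaTwo` (`LocalNormFibreNonsplit`),
in a PARAMETRIC form (`isLocalNormPair_of_entries`) along which a continuous section can be run.  THEOREMS ONLY (no definition, no instance, no notation, no named
fact, no `sorry`); ★-only imports (FILE A ★ p851427 `LocalUnitaryRankTwoHilbertSection` of S13c).  HONEST LABEL: HC_CM is proved only modulo the 7 printed citations
(2 remaining: hLiu418 = `stmt-HodgeConjecture-24832`, h413 = `stmt-HodgeConjecture-24833`) until rung 0 closes; unconditional local algebra, count-neutral.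

THE MATHEMATICS.  `R = ∏_{w ∣ v} L_w`, `σ = c ⊗ 1`, `y ∈ U(Φ₃)(L⁺_v)` with `charpoly y = X³ − e₁X² + e₂X − e₃`.  §1 UNITARY RECIPROCITY: `σ(e₃)·e₃ = 1` (determinants in
`ᵗ(σy)Φ₃y = Φ₃`) and **`σ(e₁)·e₃ = e₂`** — because `y⁻¹ = Φ₃ ᵗ(σy) Φ₃` (so `tr y⁻¹ = σ e₁`) while `y⁻¹ = e₃⁻¹·adj y` and `tr adj y = e₂` (Jacobi, ★
`trace_adjugate_scalar_sub_eq_eval_derivative_charpoly` at `t = 0`).  §2 For a root `u` with `σu·u = 1` put `t := e₁ − u`, `d := e₃·σu`; then `σd·d = 1`,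
`σt·d = t` and `charpoly y = (X² − tX + d)(X − u)` (coefficientwise, from the root equation and §1).  §3 Any `γ_H = (h, u′) ∈ H_v` with `h = [[0, e], [k, t]]`,
`e·σk = 1`, `k = −d·σk`, `u′ = u` has `charpoly ι(γ_H) = charpoly h · (X − u) = (X² − tX + d)(X − u) = charpoly y` (★ `charpoly_endoEmbLocal`), hence is `G`-regular and
MATCHES `y` (equal separable characteristic polynomials ⇒ `GL₃(R)`-conjugate, ★ `exists_units_conj_eq_of_charpoly_eq_of_separable`; the correspondence is
`GL₃`-conjugacy); FILE A's Hilbert-90 chart supplies such `k`, whence EXISTENCE (`exists_isLocalNormPair_of_isRoot_of_norm_one`).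
* §1 `cmLocalForm_three_mul_self`, `conj_det_mul_det`, `conj_trace_mul_det`;  §2 `invariants_of_norm_one_root`;  §3 `cmLocalForm_one_eq`, `nonsingInvUnit_mem_local_one`,
  `isLocalGRegular_and_isLocalNormPair_of_charpoly_eq`, `isLocalNormPair_of_entries` (parametric), `exists_isLocalNormPair_of_isRoot_of_norm_one` (HEAD).

## References
* [Rogawski1990] J. D. Rogawski, *Automorphic Representations of Unitary Groups in Three Variables*, Ann. of Math. Stud. 123 (1990): §5.4 p. 78 (the stable classes of `H`
  transferring to a class); §4.3 p. 43 (`γ_H → γ`); §3.1 p. 19 (stable conjugacy = `GL_n`-conjugacy); §1.9 p. 8 (`E_v`, the involution).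
* [HornJohnson2013] R. A. Horn, C. R. Johnson, *Matrix Analysis*, 2nd ed. (2013): (0.8.10.1) (Jacobi), 3.3.P12.
-/

set_option autoImplicit false
set_option linter.dupNamespace false

noncomputable section

open NumberField IsDedekindDomain Matrix Polynomial
open scoped MatrixGroups
open Literature.NumberTheory.Rogawski1990 Literature.NumberTheory.Automorphic Literature.NumberTheory.Automorphic.UnitaryGroup

namespace Summit.HodgeConjecture.HodgeConjecture.Cruxes.H413.F0P3cStCharTSFibreRealise

variable (L : Type) [Field L] [NumberField L] [IsCMField L] (v : HeightOneSpectrum (𝓞 ↥(maximalRealSubfield L)))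

/-! ## §1 Unitary reciprocity of the characteristic polynomial of `y ∈ U(Φ₃)(L⁺_v)` -/

omit [IsCMField L] in
/-- The local split form of rank `3` squares to `1`. -/
theorem cmLocalForm_three_mul_self : cmLocalForm L 3 v * cmLocalForm L 3 v = 1 := by
  rw [cmLocalForm_eq_over]; exact (StdForm.antidiagonal 3).over_mul_over _

/-- **`σ(det y)·det y = 1`** for `y ∈ U(Φ₃)(L⁺_v)` (determinants in `ᵗ(σy) Φ₃ y = Φ₃`, `det Φ₃` a unit). [cite: Rogawski1990, §1.9 p. 8] -/
theorem conj_det_mul_det (y : Gqs L v) :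
    conjLocal L (IsCMField.complexConj L) v (y.val : GL (Fin 3) (UnitaryGroup.LocalRing L v)).val.det *
      (y.val : GL (Fin 3) (UnitaryGroup.LocalRing L v)).val.det = 1 := by
  set Y := (y.val : GL (Fin 3) (UnitaryGroup.LocalRing L v)).val with hY
  have hmem : (Y.map (conjLocal L (IsCMField.complexConj L) v))ᵀ * cmLocalForm L 3 v * Y = cmLocalForm L 3 v :=
    mem_unitaryGroupOfForm_iff.1 y.2
  have hJ : IsUnit (cmLocalForm L 3 v).det := by
    refine isUnit_iff_exists_inv.2 ⟨(cmLocalForm L 3 v).det, ?_⟩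
    rw [← Matrix.det_mul, cmLocalForm_three_mul_self, Matrix.det_one]
  have h := congrArg Matrix.det hmem
  rw [Matrix.det_mul, Matrix.det_mul, Matrix.det_transpose, ← RingHom.mapMatrix_apply, ← RingHom.map_det] at h
  -- `σ(det Y) · det J · det Y = det J`
  have h' : (conjLocal L (IsCMField.complexConj L) v Y.det * Y.det) * (cmLocalForm L 3 v).det = 1 * (cmLocalForm L 3 v).det := by
    rw [one_mul]; linear_combination h
  exact hJ.mul_right_cancel h'

/-- **`σ(tr y)·det y = e₂(y)`** (`e₂` = the `X`-coefficient of `charpoly y`) for `y ∈ U(Φ₃)(L⁺_v)`: `y⁻¹ = Φ₃ ᵗ(σy) Φ₃` so `tr y⁻¹ = σ(tr y)`, and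
`tr y⁻¹ = det y⁻¹ · tr adj(y) = σ(det y)·e₂` (Jacobi ★ `trace_adjugate_scalar_sub_eq_eval_derivative_charpoly` at `t = 0`). [cite: Rogawski1990, §1.9 p. 8] -/
theorem conj_trace_mul_det (y : Gqs L v) :
    conjLocal L (IsCMField.complexConj L) v (y.val : GL (Fin 3) (UnitaryGroup.LocalRing L v)).val.trace *
      (y.val : GL (Fin 3) (UnitaryGroup.LocalRing L v)).val.det =
    ((y.val : GL (Fin 3) (UnitaryGroup.LocalRing L v)).val.charpoly).coeff 1 := by
  set σ := conjLocal L (IsCMField.complexConj L) v with hσ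
  set Y := (y.val : GL (Fin 3) (UnitaryGroup.LocalRing L v)).val with hY
  set J := cmLocalForm L 3 v with hJ
  have hmem : (Y.map σ)ᵀ * J * Y = J := mem_unitaryGroupOfForm_iff.1 y.2
  have hJJ : J * J = 1 := cmLocalForm_three_mul_self L v
  -- `Y⁻¹ = J ᵗ(σY) J`
  have hinv : Y⁻¹ = J * (Y.map σ)ᵀ * J := by
    refine Matrix.inv_eq_left_inv ?_
    calc J * (Y.map σ)ᵀ * J * Y = J * ((Y.map σ)ᵀ * J * Y) := by simp only [Matrix.mul_assoc]
      _ = 1 := by rw [hmem, hJJ]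
  have htr_inv : Y⁻¹.trace = σ Y.trace := by
    rw [hinv, Matrix.trace_mul_cycle, hJJ, Matrix.one_mul, Matrix.trace_transpose, Matrix.trace_fin_three, Matrix.trace_fin_three]
    simp only [Matrix.map_apply, map_add]
  -- `Y⁻¹ = σ(det Y) • adj Y`
  have hdd : σ Y.det * Y.det = 1 := conj_det_mul_det L v y
  have hdu : IsUnit Y.det := isUnit_iff_exists_inv'.2 ⟨σ Y.det, hdd⟩
  have hri : Ring.inverse Y.det = σ Y.det := by
    calc Ring.inverse Y.det = Ring.inverse Y.det * (σ Y.det * Y.det) := by rw [hdd, mul_one]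
      _ = σ Y.det * (Ring.inverse Y.det * Y.det) := by ring
      _ = σ Y.det := by rw [Ring.inverse_mul_cancel _ hdu, mul_one]
  have htr_inv' : Y⁻¹.trace = σ Y.det * Y.adjugate.trace := by
    rw [Matrix.inv_def, hri, Matrix.trace_smul, smul_eq_mul]
  -- Jacobi at `t = 0`: `tr adj(−Y) = charpoly′(0) = e₂`, and `adj(−Y) = adj Y` in rank 3
  have hjac := F0P3cStCharTSAdjugateEigen.trace_adjugate_scalar_sub_eq_eval_derivative_charpoly Y 0
  have hneg : scalar (Fin 3) (0 : UnitaryGroup.LocalRing L v) - Y = (-1 : UnitaryGroup.LocalRing L v) • Y := by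
    simp
  rw [hneg, Matrix.adjugate_smul, Fintype.card_fin, show (3 - 1 : ℕ) = 2 from rfl, neg_one_sq, one_smul,
    ← Polynomial.coeff_zero_eq_eval_zero, Polynomial.coeff_derivative] at hjac
  simp only [Nat.cast_zero, zero_add, mul_one] at hjac
  -- assemble: `σ tr = σ det · e₂`, times `det`
  have key : σ Y.trace = σ Y.det * Y.charpoly.coeff 1 := by rw [← htr_inv, htr_inv', hjac]
  calc σ Y.trace * Y.det = Y.charpoly.coeff 1 * (σ Y.det * Y.det) := by rw [key]; ring
    _ = Y.charpoly.coeff 1 := by rw [hdd, mul_one]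

/-! ## §2 The invariants `(t, d) = (tr y − u, det y · σu)` of a norm-one root `u` and the factorisation `charpoly y = (X² − tX + d)(X − u)` -/

/-- **Invariants of a norm-one root.**  For `y ∈ U(Φ₃)(L⁺_v)` and a root `u` of `charpoly y` with `σu·u = 1`: with `t := tr y − u`, `d := det y · σu`,
`σd·d = 1`, `σt·d = t`, and `charpoly y = (X² − t X + d)·(X − u)`. [cite: Rogawski1990, §4.3 p. 43; §1.9 p. 8] -/
theorem invariants_of_norm_one_root (y : Gqs L v) {u : UnitaryGroup.LocalRing L v}
    (hu : ((y.val : GL (Fin 3) (UnitaryGroup.LocalRing L v)).val.charpoly).IsRoot u)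
    (hu1 : conjLocal L (IsCMField.complexConj L) v u * u = 1) :
    conjLocal L (IsCMField.complexConj L) v ((y.val : GL (Fin 3) (UnitaryGroup.LocalRing L v)).val.det * conjLocal L (IsCMField.complexConj L) v u) *
        ((y.val : GL (Fin 3) (UnitaryGroup.LocalRing L v)).val.det * conjLocal L (IsCMField.complexConj L) v u) = 1 ∧
      conjLocal L (IsCMField.complexConj L) v ((y.val : GL (Fin 3) (UnitaryGroup.LocalRing L v)).val.trace - u) *
        ((y.val : GL (Fin 3) (UnitaryGroup.LocalRing L v)).val.det * conjLocal L (IsCMField.complexConj L) v u) =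
        (y.val : GL (Fin 3) (UnitaryGroup.LocalRing L v)).val.trace - u ∧
      (X ^ 2 - C ((y.val : GL (Fin 3) (UnitaryGroup.LocalRing L v)).val.trace - u) * X +
          C ((y.val : GL (Fin 3) (UnitaryGroup.LocalRing L v)).val.det * conjLocal L (IsCMField.complexConj L) v u)) * (X - C u) =
        (y.val : GL (Fin 3) (UnitaryGroup.LocalRing L v)).val.charpoly := by
  haveI : Nontrivial (UnitaryGroup.LocalRing L v) := UnitaryGroup.nontrivial_localRing L v
  set σ := conjLocal L (IsCMField.complexConj L) v with hσ
  set Y := (y.val : GL (Fin 3) (UnitaryGroup.LocalRing L v)).val with hY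
  set p := Y.charpoly with hp
  -- the coefficients of `p = X³ − e₁ X² + e₂ X − e₃`
  set e₁ := Y.trace with he₁
  set e₂ := p.coeff 1 with he₂
  set e₃ := Y.det with he₃
  have hmon : p.Monic := Matrix.charpoly_monic _
  have hdeg : p.natDegree = 3 := by rw [hp, Matrix.charpoly_natDegree_eq_dim, Fintype.card_fin]
  have hc3 : p.coeff 3 = 1 := by rw [← hdeg]; exact hmon.coeff_natDegree
  have hc2 : p.coeff 2 = -e₁ := by
    have h := Matrix.trace_eq_neg_charpoly_coeff Y
    rw [Fintype.card_fin, show (3 - 1 : ℕ) = 2 from rfl] at h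
    rw [he₁, h, neg_neg]
  have hc0 : p.coeff 0 = -e₃ := by
    have h := Matrix.det_eq_sign_charpoly_coeff Y
    rw [Fintype.card_fin] at h
    rw [he₃, h]; ring
  have hcge : ∀ n, 4 ≤ n → p.coeff n = 0 := fun n hn =>
    Polynomial.coeff_eq_zero_of_natDegree_lt (by rw [hdeg]; omega)
  -- the root equation `u³ − e₁u² + e₂u − e₃ = 0`
  have hroot : u ^ 3 - e₁ * u ^ 2 + e₂ * u - e₃ = 0 := by
    have h := hu
    rw [Polynomial.IsRoot, Polynomial.eval_eq_sum_range, hdeg] at h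
    simp only [Finset.sum_range_succ, Finset.sum_range_zero, zero_add, pow_zero, mul_one, pow_one, hc0, hc2, hc3, one_mul] at h
    rw [← he₂] at h
    linear_combination h
  -- unitary reciprocity
  have hdd : σ e₃ * e₃ = 1 := conj_det_mul_det L v y
  have htd : σ e₁ * e₃ = e₂ := conj_trace_mul_det L v y
  refine ⟨?_, ?_, ?_⟩
  · rw [map_mul, hσ, conjLocal_conjLocal_cm, ← hσ]
    linear_combination (u * σ u) * hdd + hu1
  · rw [map_sub]
    -- `(σe₁ − σu)·(e₃·σu) = e₁ − u`, using `σe₁ e₃ = e₂`, `σu·u = 1` and the root equation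
    have h1 : (σ e₁ - σ u) * (e₃ * σ u) = e₂ * σ u - e₃ * σ u * σ u := by linear_combination (σ u) * htd
    rw [h1]
    linear_combination (σ u) ^ 2 * hroot + (-(e₂) * σ u + (e₁ - u) * (σ u * u + 1)) * hu1
  · -- compare coefficients of `q · (X − u)` and `p`, `q := X² − tX + d`
    set q : (UnitaryGroup.LocalRing L v)[X] := X ^ 2 - C (e₁ - u) * X + C (e₃ * σ u) with hq
    have hq0 : q.coeff 0 = e₃ * σ u := by simp [hq, coeff_X, coeff_C, coeff_X_pow]
    have hq1 : q.coeff 1 = -(e₁ - u) := by simp [hq, coeff_C, coeff_X_pow]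
    have hq2 : q.coeff 2 = 1 := by simp [hq, coeff_X_pow]
    have hq3 : q.coeff 3 = 0 := by simp [hq, coeff_X_pow]
    have hdq : (q * (X - C u)).natDegree ≤ 3 := by rw [hq]; compute_degree!
    refine Polynomial.ext fun n => ?_
    rcases Nat.lt_or_ge n 4 with hn | hn
    · interval_cases n
      · rw [Polynomial.mul_coeff_zero, hq0, hc0]
        simp only [coeff_sub, coeff_X_zero, coeff_C_zero, zero_sub, mul_neg]
        linear_combination (-e₃) * hu1
      · rw [show (1 : ℕ) = 0 + 1 from rfl, Polynomial.coeff_mul_X_sub_C, hq0, hq1, ← he₂]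
        linear_combination (-(σ u)) * hroot + (e₂ - e₁ * u + u ^ 2) * hu1
      · rw [show (2 : ℕ) = 1 + 1 from rfl, Polynomial.coeff_mul_X_sub_C, hq1, hq2, hc2]
        ring
      · rw [show (3 : ℕ) = 2 + 1 from rfl, Polynomial.coeff_mul_X_sub_C, hq2, hq3, hc3]
        ring
    · rw [hcge n hn, Polynomial.coeff_eq_zero_of_natDegree_lt (lt_of_le_of_lt hdq (by omega))]

/-! ## §3 Matching from the characteristic polynomial; the explicit matched pair; existence -/

omit [IsCMField L] in
/-- The local split form of rank `1` is `(1)`. -/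
theorem cmLocalForm_one_eq : cmLocalForm L 1 v = !![(1 : UnitaryGroup.LocalRing L v)] := by
  rw [cmLocalForm_eq_over]
  ext i j
  simp only [StdForm.over, Matrix.map_apply, StdForm.antidiagonal_J_apply]
  fin_cases i; fin_cases j; simp

/-- A norm-one scalar `u` (`σu·u = 1`) as an element of `U(Φ₁)(L⁺_v)`: `nonsingInvUnit (u)` is a member. -/
theorem nonsingInvUnit_mem_local_one {u : UnitaryGroup.LocalRing L v} (hu1 : conjLocal L (IsCMField.complexConj L) v u * u = 1)
    (hdet : IsUnit (!![u] : Matrix (Fin 1) (Fin 1) (UnitaryGroup.LocalRing L v)).det) :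
    Matrix.nonsingInvUnit (!![u]) hdet ∈ unitaryGroupOfForm (conjLocal L (IsCMField.complexConj L) v) (cmLocalForm L 1 v) := by
  rw [mem_unitaryGroupOfForm_iff, cmLocalForm_one_eq]
  apply Matrix.ext
  intro i j
  fin_cases i; fin_cases j
  simp [Matrix.mul_apply, Matrix.nonsingInvUnit]
  exact hu1

/-- **Matching from the characteristic polynomial.**  If `charpoly ι_v(γ_H) = charpoly y` with `y ∈ U(Φ₃)(L⁺_v)` regular, then `γ_H` is `G`-regular and matches `y`
(two elements of `GL₃(∏ L_w)` with the same separable characteristic polynomial are conjugate, ★ `exists_units_conj_eq_of_charpoly_eq_of_separable`; stable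
conjugacy ∕ the correspondence is `GL₃`-conjugacy, [§3.1]). [cite: Rogawski1990, §3.1 p. 19; §4.3 p. 43] -/
theorem isLocalGRegular_and_isLocalNormPair_of_charpoly_eq
    (s : (UnitaryGroup.cmDatum L 2 (Matrix.of fun i j : Fin 2 => if i.val + j.val + 1 = 2 then (1 : L) else 0)).Local v ×
      (UnitaryGroup.cmDatum L 1 (Matrix.of fun i j : Fin 1 => if i.val + j.val + 1 = 1 then (1 : L) else 0)).Local v)
    (y : Gqs L v) (hy : IsRegularElt (y.val : GL (Fin 3) (UnitaryGroup.LocalRing L v)))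
    (hχ : ((endoEmbLocal L v s).val : GL (Fin 3) (UnitaryGroup.LocalRing L v)).val.charpoly = (y.val : GL (Fin 3) (UnitaryGroup.LocalRing L v)).val.charpoly) :
    IsLocalGRegular L v s ∧ IsLocalNormPair L (qsForm L) v s y := by
  have key : IsLocalGRegular L v s ↔ IsRegularElt ((endoEmbLocal L v s).val : GL (Fin 3) (UnitaryGroup.LocalRing L v)) := Iff.rfl
  have hreg : IsLocalGRegular L v s := by
    rw [key, isRegularElt_iff, hχ]; exact hy
  refine ⟨hreg, ?_⟩
  obtain ⟨g, hg⟩ := Literature.LinearAlgebra.Matrix.exists_units_conj_eq_of_charpoly_eq_of_separable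
    (K := fun w' : UnitaryGroup.PlacesOver L v => w'.1.adicCompletion L)
    ((endoEmbLocal L v s).val : GL (Fin 3) (UnitaryGroup.LocalRing L v)) (y.val : GL (Fin 3) (UnitaryGroup.LocalRing L v))
    ((key.1 hreg)) hχ.symm
  rw [isLocalNormPair_iff]
  exact isConj_iff.2 ⟨g, hg⟩

/-- **The explicit matched pair (parametric form, for continuity arguments).**  `y ∈ U(Φ₃)(L⁺_v)` regular, `u` a root of `charpoly y` with `σu·u = 1`,
`t = tr y − u`, `d = det y · σu`; for ANY `e, k ∈ R` with `e·σk = 1` and `k = −d·σk`, every `γ_H = (h, u′) ∈ H_v` whose `U(Φ₂)`-part has matrix `[[0, e], [k, t]]` and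
whose `U(Φ₁)`-entry is `u` is `G`-regular, matches `y`, and has `U(1)`-slot `u`. [cite: Rogawski1990, §4.3 p. 43; §5.4 p. 78] -/
theorem isLocalNormPair_of_entries (y : Gqs L v) (hy : IsRegularElt (y.val : GL (Fin 3) (UnitaryGroup.LocalRing L v)))
    {u : UnitaryGroup.LocalRing L v} (hu : ((y.val : GL (Fin 3) (UnitaryGroup.LocalRing L v)).val.charpoly).IsRoot u)
    (hu1 : conjLocal L (IsCMField.complexConj L) v u * u = 1) {e k : UnitaryGroup.LocalRing L v}
    (he : e * conjLocal L (IsCMField.complexConj L) v k = 1)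
    (hk : k = -((y.val : GL (Fin 3) (UnitaryGroup.LocalRing L v)).val.det * conjLocal L (IsCMField.complexConj L) v u) * conjLocal L (IsCMField.complexConj L) v k)
    (s : (UnitaryGroup.cmDatum L 2 (Matrix.of fun i j : Fin 2 => if i.val + j.val + 1 = 2 then (1 : L) else 0)).Local v ×
      (UnitaryGroup.cmDatum L 1 (Matrix.of fun i j : Fin 1 => if i.val + j.val + 1 = 1 then (1 : L) else 0)).Local v)
    (hs1 : (s.1.val : GL (Fin 2) (UnitaryGroup.LocalRing L v)).val = !![0, e; k, (y.val : GL (Fin 3) (UnitaryGroup.LocalRing L v)).val.trace - u])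
    (hs2 : (s.2.val : GL (Fin 1) (UnitaryGroup.LocalRing L v)).val 0 0 = u) :
    IsLocalGRegular L v s ∧ IsLocalNormPair L (qsForm L) v s y ∧ finGammaTwo L v s = u := by
  haveI : Nontrivial (UnitaryGroup.LocalRing L v) := UnitaryGroup.nontrivial_localRing L v
  obtain ⟨-, -, hfac⟩ := invariants_of_norm_one_root L v y hu hu1
  have hu' : finGammaTwo L v s = u := by unfold finGammaTwo; exact hs2
  have hχ2 : finCharpolyTwo L v s = X ^ 2 - C ((y.val : GL (Fin 3) (UnitaryGroup.LocalRing L v)).val.trace - u) * X +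
      C ((y.val : GL (Fin 3) (UnitaryGroup.LocalRing L v)).val.det * conjLocal L (IsCMField.complexConj L) v u) := by
    unfold finCharpolyTwo
    rw [Matrix.charpoly_fin_two, hs1, Matrix.trace_fin_two_of, Matrix.det_fin_two_of, zero_add]
    congr 2
    -- `0·t − e·k = d`
    rw [hk]
    linear_combination ((y.val : GL (Fin 3) (UnitaryGroup.LocalRing L v)).val.det * conjLocal L (IsCMField.complexConj L) v u) * he
  have hχ : ((endoEmbLocal L v s).val : GL (Fin 3) (UnitaryGroup.LocalRing L v)).val.charpoly = (y.val : GL (Fin 3) (UnitaryGroup.LocalRing L v)).val.charpoly := by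
    rw [charpoly_endoEmbLocal, hu', hχ2, hfac]
  exact ⟨(isLocalGRegular_and_isLocalNormPair_of_charpoly_eq L v s y hy hχ).1, (isLocalGRegular_and_isLocalNormPair_of_charpoly_eq L v s y hy hχ).2, hu'⟩

/-- **S13d «FIBRE-REALISE» — A NORM-ONE ROOT IS A MATCHED STABLE CLASS.**  At a non-split place `v`: for `y ∈ U(Φ₃)(L⁺_v)` regular semisimple and a root `u ∈ ∏ L_w`
of `charpoly y` with `σu·u = 1`, there is a `G`-regular `γ_H ∈ H_v = U(Φ₂) × U(Φ₁)` matching `y` (`ι(γ_H) ↔ y`) with `U(1)`-slot `u` — namely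
`([[0, (σk)⁻¹], [k, tr y − u]], (u))` with the Hilbert-90 chart `k` of `d = det y · σu` (★ FILE A).  Converse of ★ `IsLocalNormPair.isRoot_finGammaTwo`: the norm
fibre of `y` is in bijection with the norm-one roots of `charpoly y`. [cite: Rogawski1990, §5.4 p. 78; §4.3 p. 43; §3.1 p. 19] -/
theorem exists_isLocalNormPair_of_isRoot_of_norm_one (hns : ∀ w : UnitaryGroup.PlacesOver L v, IsCMField.complexConj L • w.1 = w.1)
    (y : Gqs L v) (hy : IsRegularElt (y.val : GL (Fin 3) (UnitaryGroup.LocalRing L v)))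
    {u : UnitaryGroup.LocalRing L v} (hu : ((y.val : GL (Fin 3) (UnitaryGroup.LocalRing L v)).val.charpoly).IsRoot u)
    (hu1 : conjLocal L (IsCMField.complexConj L) v u * u = 1) :
    ∃ s : (UnitaryGroup.cmDatum L 2 (Matrix.of fun i j : Fin 2 => if i.val + j.val + 1 = 2 then (1 : L) else 0)).Local v ×
        (UnitaryGroup.cmDatum L 1 (Matrix.of fun i j : Fin 1 => if i.val + j.val + 1 = 1 then (1 : L) else 0)).Local v,
      IsLocalGRegular L v s ∧ IsLocalNormPair L (qsForm L) v s y ∧ finGammaTwo L v s = u := by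
  obtain ⟨w⟩ := UnitaryGroup.PlacesOver.nonempty L v
  have hw := hns w
  set σ := conjLocal L (IsCMField.complexConj L) v with hσ
  set t := (y.val : GL (Fin 3) (UnitaryGroup.LocalRing L v)).val.trace - u with ht'
  set d := (y.val : GL (Fin 3) (UnitaryGroup.LocalRing L v)).val.det * σ u with hd'
  obtain ⟨hd, ht, -⟩ := invariants_of_norm_one_root L v y hu hu1
  obtain ⟨ε, Ck, -, hchart⟩ := exists_hilbert90_chart_constants w hw
  obtain ⟨k, hk, hku, -, -⟩ := hchart d hd
  have hσku : IsUnit (σ k) := hku.map σ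
  obtain ⟨g, hgmem, hgval, -, -, -⟩ := exists_mem_local_two_of_invariants t d k hd ht hk hσku
  -- the `U(Φ₁)` component `(u)`
  have huu : u * σ u = 1 := by rw [mul_comm]; exact hu1
  have hdet1 : IsUnit (!![u] : Matrix (Fin 1) (Fin 1) (UnitaryGroup.LocalRing L v)).det := by
    rw [Matrix.det_fin_one_of]; exact isUnit_iff_exists_inv.2 ⟨σ u, huu⟩
  refine ⟨(⟨g, hgmem⟩, ⟨Matrix.nonsingInvUnit (!![u]) hdet1, nonsingInvUnit_mem_local_one L v hu1 hdet1⟩), ?_⟩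
  refine isLocalNormPair_of_entries L v y hy hu hu1 (e := (↑(hσku.unit⁻¹) : UnitaryGroup.LocalRing L v)) (k := k) hσku.unit.inv_mul hk _ hgval ?_
  simp [Matrix.nonsingInvUnit]

end Summit.HodgeConjecture.HodgeConjecture.Cruxes.H413.F0P3cStCharTSFibreRealise

end
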